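import Literature.Probability.LatticeModels.ScaleFrameTwoGraphsLevel
import Literature.Analysis.Convexity.DoeblinRatioStep
import HarnessLib

/-!
# Ratio forgetting across two graphs sharing a window (Kesten's scheme, planarity-free): the core
(proved)

Topic `Literature/Probability/LatticeModels` (trunk `StatMech`, family `crit-ising`). Two finite graphs
`G₁, G₂` carrying scale frames `F₁, F₂` that agree (adjacency, radius, goodness) on a common vertex
window `Wt` whose core `W₀` contains every good vertex below the top of the level-`L` block; anchors
`x, x'` joined by base walks deep inside; far targets `y₁, y₂`. GIVEN the one-frame ratio bound of
Kesten's scheme in the frame `F₁` (H. Kesten, PTRF 73 (1986), Thm. 3 / Lemma (23); here the hypothesis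
`hRB`: `u_x(d) u_{x'}(d₂) ≤ Q_L u_{x'}(d) u_x(d₂)` for the conditional inside probabilities of the
level-`L` data), the double ratio of connection probabilities obeys
(`ScaleFrame.ratio_forgetting_two_graphs_of_ratioBound`)

  `P₁[x ↔ y₁] P₂[x' ↔ y₂] ≤ Q_L / (1 - (1-c)^{m/2})² · P₁[x' ↔ y₁] P₂[x ↔ y₂]`.

Proof: the top-level decomposition over the WINDOW data in each graph
(`ScaleFrame.exists_windowSum_add_junk`: `Pᵢ[z ↔ yᵢ] = Σ_d tᵢ(d) uᵢ,z(d) + junk`, junk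
`≤ (1-c)^{m/2}`), the transport `u₁,z(d) = u₂,z(d)` of the conditional inside probabilities across the
window (`ScaleFrame.insideCond_eq_of_frames`, from `insideCond_eq_of_window_iso_off` and the window-local
realisability `real_datumEventOff_pos_of_window`), the positivity pattern `u_x(d) > 0 ↔ u_{x'}(d) > 0`
(base-walk surgery `real_datumOff_insidePiece_pos_of_walk`), and the two-weight averaging
`ratio_div_ratio_le_of_overlap` with overlap `β = 0` and ratio bounds `A = min u_x/u_{x'}`,
`B = max ≤ Q_L A`.

Everything is proved; no definitions, no named facts.

## References

* [Kesten1986] H. Kesten, *Probab. Theory Related Fields* 73 (1986) 369–394, proof of Thm. 3.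
* [BasuSapozhnikov2017ECP] D. Basu, A. Sapozhnikov, ECP 22 (2017) no. 26, §2.
-/

open MeasureTheory Finset SimpleGraph
open Literature.Probability.Percolation (BondConfig openConn openConnIn explSet explRim explEvent)

namespace Literature.Probability.LatticeModels

namespace ScaleFrame

/-! ### Transport of the conditional inside probabilities between the two frames -/

/-- **The conditional inside probability of a window datum is the same in the two graphs.** Frames
`F₁, F₂` on `G₁, G₂` agreeing (radius, goodness) on the window `ι₁, ι₂ : Wt ↪ Vᵢ` with the same
adjacency, a core `W₀` without neighbours off the window containing every good vertex of radius
`< a_K M^m + 2ηᵢ`, and an anchor `z` with `ι₂ z ∈ inSet a_K`. For a window datum `d` whose off-wired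
datum event (exploration of `annSet a_K (a_K M^m)` from `inSet a_K`) is non-null in `G₂`,
`P₁[F₁(ι₁ d) ∩ InP_z] / P₁[F₁(ι₁ d)] = P₂[F₂(ι₂ d) ∩ InP_z] / P₂[F₂(ι₂ d)]`: the regions are images of
the same window sets, the datum is carried by the core (a realising configuration has
`𝒞 = ι₂ d.1 ⊆ inSet ∪ annSet`), realisability transports to `G₁` (`real_datumEventOff_pos_of_window`),
and `insideCond_eq_of_window_iso_off` applies. [cite: BasuSapozhnikov2017ECP, §2] -/
theorem insideCond_eq_of_frames {V₁ V₂ Wt : Type*} [Fintype V₁] [DecidableEq V₁] [Fintype V₂]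
    [DecidableEq V₂] [Fintype Wt] [DecidableEq Wt] (F₁ : ScaleFrame V₁) (F₂ : ScaleFrame V₂)
    (G₁ : SimpleGraph V₁) [DecidableRel G₁.Adj] (G₂ : SimpleGraph V₂) [DecidableRel G₂.Adj]
    (ι₁ : Wt ↪ V₁) (ι₂ : Wt ↪ V₂) (W₀ : Set Wt) {p q aK T : ℝ} (z : Wt)
    (hp : p ∈ Set.Ioo (0 : ℝ) 1) (hq : 0 < q) (hT : aK ≤ T)
    (hadj : ∀ a b : Wt, G₁.Adj (ι₁ a) (ι₁ b) ↔ G₂.Adj (ι₂ a) (ι₂ b))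
    (hnb₁ : ∀ w ∈ W₀, ∀ v : V₁, G₁.Adj (ι₁ w) v → ∃ b : Wt, v = ι₁ b)
    (hnb₂ : ∀ w ∈ W₀, ∀ v : V₂, G₂.Adj (ι₂ w) v → ∃ b : Wt, v = ι₂ b)
    (hrad : ∀ w : Wt, F₁.rad (ι₁ w) = F₂.rad (ι₂ w)) (hgood : ∀ w : Wt, ι₁ w ∈ F₁.good ↔ ι₂ w ∈ F₂.good)
    (hcore₁ : ∀ v : V₁, v ∈ F₁.good → F₁.rad v < T + 2 * F₁.η → ∃ w ∈ W₀, v = ι₁ w)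
    (hcore₂ : ∀ v : V₂, v ∈ F₂.good → F₂.rad v < T + 2 * F₂.η → ∃ w ∈ W₀, v = ι₂ w)
    (hz : ι₂ z ∈ F₂.inSet aK) (d : Finset Wt × Finset Wt)
    (hpos : 0 < (rcMeasure G₂ p q ∅).real
      {ω | ω ∩ (↑G₂.edgeFinset : Set (Sym2 V₂)) ∈
        explEvent (F₂.inSet aK) (F₂.annSet aK T) (ι₂ '' ↑d.1) (ι₂ '' ↑d.2) ∩
        {ω | ∀ r ∈ ι₂ '' ↑d.2, ∀ r₂ ∈ ι₂ '' ↑d.2, ∃ v ∈ ι₂ '' ↑d.1 \ F₂.inSet aK,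
          ∃ v' ∈ ι₂ '' ↑d.1 \ F₂.inSet aK, s(v, r) ∈ ω ∧ s(v', r₂) ∈ ω ∧
            ω ∈ openConnIn (ι₂ '' ↑d.1 \ F₂.inSet aK) v v'}}) :
    (rcMeasure G₁ p q ∅).real
        ({ω | ω ∩ (↑G₁.edgeFinset : Set (Sym2 V₁)) ∈
            explEvent (F₁.inSet aK) (F₁.annSet aK T) (ι₁ '' ↑d.1) (ι₁ '' ↑d.2) ∩
            {ω | ∀ r ∈ ι₁ '' ↑d.2, ∀ r₂ ∈ ι₁ '' ↑d.2, ∃ v ∈ ι₁ '' ↑d.1 \ F₁.inSet aK,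
              ∃ v' ∈ ι₁ '' ↑d.1 \ F₁.inSet aK, s(v, r) ∈ ω ∧ s(v', r₂) ∈ ω ∧
                ω ∈ openConnIn (ι₁ '' ↑d.1 \ F₁.inSet aK) v v'}} ∩
          {ω | ∃ w ∈ ι₁ '' ↑d.2, ∃ v ∈ ι₁ '' ↑d.1,
            ω ∩ (↑G₁.edgeFinset : Set (Sym2 V₁)) ∈ openConnIn (ι₁ '' ↑d.1) (ι₁ z) v ∧
              s(v, w) ∈ ω ∩ (↑G₁.edgeFinset : Set (Sym2 V₁))}) /
      (rcMeasure G₁ p q ∅).real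
        {ω | ω ∩ (↑G₁.edgeFinset : Set (Sym2 V₁)) ∈
            explEvent (F₁.inSet aK) (F₁.annSet aK T) (ι₁ '' ↑d.1) (ι₁ '' ↑d.2) ∩
            {ω | ∀ r ∈ ι₁ '' ↑d.2, ∀ r₂ ∈ ι₁ '' ↑d.2, ∃ v ∈ ι₁ '' ↑d.1 \ F₁.inSet aK,
              ∃ v' ∈ ι₁ '' ↑d.1 \ F₁.inSet aK, s(v, r) ∈ ω ∧ s(v', r₂) ∈ ω ∧
                ω ∈ openConnIn (ι₁ '' ↑d.1 \ F₁.inSet aK) v v'}} =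
    (rcMeasure G₂ p q ∅).real
        ({ω | ω ∩ (↑G₂.edgeFinset : Set (Sym2 V₂)) ∈
            explEvent (F₂.inSet aK) (F₂.annSet aK T) (ι₂ '' ↑d.1) (ι₂ '' ↑d.2) ∩
            {ω | ∀ r ∈ ι₂ '' ↑d.2, ∀ r₂ ∈ ι₂ '' ↑d.2, ∃ v ∈ ι₂ '' ↑d.1 \ F₂.inSet aK,
              ∃ v' ∈ ι₂ '' ↑d.1 \ F₂.inSet aK, s(v, r) ∈ ω ∧ s(v', r₂) ∈ ω ∧
                ω ∈ openConnIn (ι₂ '' ↑d.1 \ F₂.inSet aK) v v'}} ∩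
          {ω | ∃ w ∈ ι₂ '' ↑d.2, ∃ v ∈ ι₂ '' ↑d.1,
            ω ∩ (↑G₂.edgeFinset : Set (Sym2 V₂)) ∈ openConnIn (ι₂ '' ↑d.1) (ι₂ z) v ∧
              s(v, w) ∈ ω ∩ (↑G₂.edgeFinset : Set (Sym2 V₂))}) /
      (rcMeasure G₂ p q ∅).real
        {ω | ω ∩ (↑G₂.edgeFinset : Set (Sym2 V₂)) ∈
            explEvent (F₂.inSet aK) (F₂.annSet aK T) (ι₂ '' ↑d.1) (ι₂ '' ↑d.2) ∩
            {ω | ∀ r ∈ ι₂ '' ↑d.2, ∀ r₂ ∈ ι₂ '' ↑d.2, ∃ v ∈ ι₂ '' ↑d.1 \ F₂.inSet aK,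
              ∃ v' ∈ ι₂ '' ↑d.1 \ F₂.inSet aK, s(v, r) ∈ ω ∧ s(v', r₂) ∈ ω ∧
                ω ∈ openConnIn (ι₂ '' ↑d.1 \ F₂.inSet aK) v v'}} := by
  have hp' : p ∈ Set.Icc (0 : ℝ) 1 := ⟨hp.1.le, hp.2.le⟩
  -- the window regions
  obtain ⟨Inw, hInw⟩ : ∃ S : Set Wt, S = ι₁ ⁻¹' F₁.inSet aK := ⟨_, rfl⟩
  obtain ⟨Blkw, hBlkw⟩ : ∃ S : Set Wt, S = ι₁ ⁻¹' F₁.annSet aK T := ⟨_, rfl⟩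
  have hInw₂ : Inw = ι₂ ⁻¹' F₂.inSet aK := by
    rw [hInw]; ext w
    simp only [Set.mem_preimage, mem_inSet, hrad w, hgood w]
  have hBlkw₂ : Blkw = ι₂ ⁻¹' F₂.annSet aK T := by
    rw [hBlkw]; ext w
    simp only [Set.mem_preimage, mem_annSet, hrad w, hgood w]
  have hc₁ : ∀ v : V₁, v ∈ F₁.good → F₁.rad v < T + 2 * F₁.η → v ∈ Set.range ι₁ := fun v hv hr => by
    obtain ⟨w, -, rfl⟩ := hcore₁ v hv hr; exact ⟨w, rfl⟩
  have hc₂ : ∀ v : V₂, v ∈ F₂.good → F₂.rad v < T + 2 * F₂.η → v ∈ Set.range ι₂ := fun v hv hr => by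
    obtain ⟨w, -, rfl⟩ := hcore₂ v hv hr; exact ⟨w, rfl⟩
  have hT₁ : aK < T + 2 * F₁.η := by linarith [F₁.η_pos]
  have hT₂ : aK < T + 2 * F₂.η := by linarith [F₂.η_pos]
  have hIm₁ : ι₁ '' Inw = F₁.inSet aK := hInw ▸ F₁.image_preimage_inSet ι₁ hT₁ hc₁
  have hIm₂ : ι₂ '' Inw = F₂.inSet aK := hInw₂ ▸ F₂.image_preimage_inSet ι₂ hT₂ hc₂
  have hBl₁ : ι₁ '' Blkw = F₁.annSet aK T :=
    hBlkw ▸ F₁.image_preimage_annSet ι₁ (by linarith [F₁.η_pos]) hc₁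
  have hBl₂ : ι₂ '' Blkw = F₂.annSet aK T :=
    hBlkw₂ ▸ F₂.image_preimage_annSet ι₂ (by linarith [F₂.η_pos]) hc₂
  have hInW₀ : Inw ⊆ W₀ := fun w hw => by
    rw [hInw] at hw
    obtain ⟨w', hw', h⟩ := hcore₁ _ hw.1 (by linarith [hw.2, F₁.η_pos])
    exact ι₁.injective h ▸ hw'
  have hBlkW₀ : Blkw ⊆ W₀ := fun w hw => by
    rw [hBlkw] at hw
    obtain ⟨w', hw', h⟩ := hcore₁ _ hw.1 (by linarith [hw.2.2, F₁.η_pos])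
    exact ι₁.injective h ▸ hw'
  -- a realising configuration in `G₂`: the datum is carried by the core and contains the anchor
  obtain ⟨ω₂, -, hω₂, -⟩ := exists_mem_of_rcMeasure_real_pos G₂ hp' hq ∅ hpos
  obtain ⟨hU₂, -⟩ := Percolation.mem_explEvent_iff.1 hω₂
  have hUW₀ : (↑d.1 : Set Wt) ⊆ W₀ := fun w hw => by
    have hw' : ι₂ w ∈ explSet (F₂.inSet aK) (F₂.annSet aK T)
        ((↑ω₂ : BondConfig V₂) ∩ ↑G₂.edgeFinset) := hU₂ ▸ ⟨w, hw, rfl⟩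
    have hv : ι₂ w ∈ F₂.good ∧ F₂.rad (ι₂ w) < T + 2 * F₂.η :=
      (Percolation.explSet_subset _ _ _ hw').elim
        (fun h => ⟨h.1, by linarith [h.2, F₂.η_pos]⟩) fun h => ⟨h.1, by linarith [h.2.2, F₂.η_pos]⟩
    obtain ⟨w', hw'', h⟩ := hcore₂ _ hv.1 hv.2
    exact ι₂.injective h ▸ hw''
  have hzU : z ∈ (↑d.1 : Set Wt) := by
    have h : ι₂ z ∈ ι₂ '' ↑d.1 := hU₂ ▸ Percolation.subset_explSet _ _ _ hz
    exact ι₂.injective.mem_set_image.1 h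
  -- realisability in `G₁`
  have hpos₁ := real_datumEventOff_pos_of_window G₂ G₁ ι₂ ι₁ hp hq (fun a b => (hadj a b).symm)
    Inw Blkw ↑d.1 ↑d.2 (fun a ha => hnb₂ a (hUW₀ ha)) (by rw [hIm₂, hBl₂]; exact hpos)
  rw [hIm₁, hBl₁] at hpos₁
  -- transport of the conditional inside probability
  have hT := insideCond_eq_of_window_iso_off G₁ G₂ ι₁ ι₂ W₀ hp' hq hadj hnb₁ hnb₂ Inw Blkw ↑d.1 ↑d.2 z
    hInW₀ hBlkW₀ hUW₀ hzU
  dsimp only at hT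
  rw [hIm₁, hIm₂, hBl₁, hBl₂] at hT
  rw [div_eq_div_iff hpos₁.ne' hpos.ne']
  exact hT

/-! ### The two-graph ratio forgetting, given the one-frame ratio bound -/

/-- **Ratio forgetting across two graphs sharing a window, from the one-frame ratio bound** (see
the module docstring). The hypothesis `hRB` is the conclusion of Kesten's one-frame ratio forgetting
(ABS-A) in the frame `F₁` for the anchors `ι₁ x, ι₁ x'`, read for the free random-cluster measure of
`⟨F₁.E⟩ = G₁`. [cite: Kesten1986, proof of Thm. 3] -/
theorem ratio_forgetting_two_graphs_of_ratioBound :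
    ∀ {V₁ V₂ Wt : Type*} [Fintype V₁] [DecidableEq V₁] [Fintype V₂] [DecidableEq V₂] [Fintype Wt] [DecidableEq Wt]
      (G₁ : SimpleGraph V₁) [DecidableRel G₁.Adj] (G₂ : SimpleGraph V₂) [DecidableRel G₂.Adj]
      (ι₁ : Wt ↪ V₁) (ι₂ : Wt ↪ V₂) (W₀ : Set Wt) (F₁ : ScaleFrame V₁) (F₂ : ScaleFrame V₂)
      {p q c a M : ℝ} {m g L : ℕ} (Q : ℕ → ℝ) (x x' : Wt) (y₁ : V₁) (y₂ : V₂),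
      (let P := rcMeasure (fromEdgeSet (↑F₁.E : Set (Sym2 V₁))) p q ∅
       let aL : ℝ := a * M ^ (L * (m + 17 + g))
       let Fd : Set V₁ → Set V₁ → Set (BondConfig V₁) := fun U R => {ω | ω ∩ (↑F₁.E : Set (Sym2 V₁)) ∈
         explEvent (F₁.inSet aL) (F₁.annSet aL (aL * M ^ m)) U R ∩ {ω | ∀ r ∈ R, ∀ r₂ ∈ R,
           ∃ v ∈ U \ F₁.inSet aL, ∃ v' ∈ U \ F₁.inSet aL, s(v, r) ∈ ω ∧ s(v', r₂) ∈ ω ∧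
             ω ∈ openConnIn (U \ F₁.inSet aL) v v'}}
       let InP : V₁ → Set V₁ → Set V₁ → Set (BondConfig V₁) := fun y U R => {ω | ∃ w ∈ R, ∃ v ∈ U,
         ω ∩ (↑F₁.E : Set (Sym2 V₁)) ∈ openConnIn U y v ∧ s(v, w) ∈ ω ∩ (↑F₁.E : Set (Sym2 V₁))}
       let u : V₁ → Set V₁ → Set V₁ → ℝ := fun y U R => P.real (Fd U R ∩ InP y U R) / P.real (Fd U R)
       ∀ (U R U₂ R₂ : Set V₁), 0 < u (ι₁ x) U R → 0 < u (ι₁ x) U₂ R₂ →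
         u (ι₁ x) U R * u (ι₁ x') U₂ R₂ ≤ Q L * (u (ι₁ x') U R * u (ι₁ x) U₂ R₂)) →
      p ∈ Set.Ioo (0 : ℝ) 1 → 1 ≤ q → c ≤ 1 → 0 < a → 4 ≤ M → 2 ≤ m →
      (1 - c) ^ (m / 2) < 1 →
      a * M ^ (L * (m + 17 + g) + m + 1) ≤ F₁.Rmax → a * M ^ (L * (m + 17 + g) + m + 1) ≤ F₂.Rmax →
      F₁.η ≤ a → F₂.η ≤ a →
      F₁.E = G₁.edgeFinset → F₂.E = G₂.edgeFinset →
      F₁.LadderRSWb p q c a M (L * (m + 17 + g) + m + 1) 13 → F₂.LadderRSWb p q c a M (L * (m + 17 + g) + m + 1) 13 →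
      (∀ a b : Wt, G₁.Adj (ι₁ a) (ι₁ b) ↔ G₂.Adj (ι₂ a) (ι₂ b)) →
      (∀ w ∈ W₀, ∀ v : V₁, G₁.Adj (ι₁ w) v → ∃ b : Wt, v = ι₁ b) →
      (∀ w ∈ W₀, ∀ v : V₂, G₂.Adj (ι₂ w) v → ∃ b : Wt, v = ι₂ b) →
      (∀ w : Wt, F₁.rad (ι₁ w) = F₂.rad (ι₂ w)) → (∀ w : Wt, ι₁ w ∈ F₁.good ↔ ι₂ w ∈ F₂.good) →
      (∀ v : V₁, v ∈ F₁.good → F₁.rad v < a * M ^ (L * (m + 17 + g)) * M ^ m + 2 * F₁.η → ∃ w ∈ W₀, v = ι₁ w) →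
      (∀ v : V₂, v ∈ F₂.good → F₂.rad v < a * M ^ (L * (m + 17 + g)) * M ^ m + 2 * F₂.η → ∃ w ∈ W₀, v = ι₂ w) →
      (∃ w : (fromEdgeSet (↑F₁.E : Set (Sym2 V₁))).Walk (ι₁ x) (ι₁ x'), ∀ z ∈ w.support, z ∈ F₁.good ∧ F₁.rad z < a - F₁.η) →
      (∃ w : (fromEdgeSet (↑F₂.E : Set (Sym2 V₂))).Walk (ι₂ x) (ι₂ x'), ∀ z ∈ w.support, z ∈ F₂.good ∧ F₂.rad z < a - F₂.η) →
      (y₁ ∈ F₁.good → a * M ^ (L * (m + 17 + g)) * M ^ m + F₁.η ≤ F₁.rad y₁) →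
      (y₂ ∈ F₂.good → a * M ^ (L * (m + 17 + g)) * M ^ m + F₂.η ≤ F₂.rad y₂) →
      0 < (rcMeasure G₁ p q ∅).real (openConn (ι₁ x) y₁) → 0 < (rcMeasure G₁ p q ∅).real (openConn (ι₁ x') y₁) →
      0 < (rcMeasure G₂ p q ∅).real (openConn (ι₂ x) y₂) → 0 < (rcMeasure G₂ p q ∅).real (openConn (ι₂ x') y₂) →
      (rcMeasure G₁ p q ∅).real (openConn (ι₁ x) y₁) * (rcMeasure G₂ p q ∅).real (openConn (ι₂ x') y₂) ≤
        Q L / (1 - (1 - c) ^ (m / 2)) ^ 2 *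
          ((rcMeasure G₁ p q ∅).real (openConn (ι₁ x') y₁) * (rcMeasure G₂ p q ∅).real (openConn (ι₂ x) y₂)) := by
  intro V₁ V₂ Wt _ _ _ _ _ _ G₁ _ G₂ _ ι₁ ι₂ W₀ F₁ F₂ p q c a M m g L Q x x' y₁ y₂ hRB hp hq hc1 ha hM hm hε
    hR₁ hR₂ hη₁ hη₂ hE₁ hE₂ hL₁ hL₂ hadj hnb₁ hnb₂ hrad hgood hcore₁ hcore₂ hw₁ hw₂ hy₁ hy₂ hN₁pos hM₁pos
    hN₂pos hM₂pos
  dsimp only at hRB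
  have hq0 : 0 < q := one_pos.trans_le hq
  have hp' : p ∈ Set.Icc (0 : ℝ) 1 := ⟨hp.1.le, hp.2.le⟩
  haveI := isProbabilityMeasure_rcMeasure G₁ hp' hq0 ∅
  haveI := isProbabilityMeasure_rcMeasure G₂ hp' hq0 ∅
  have hm1 : 1 ≤ m := by omega
  obtain ⟨-, haK₁, -, hTop₁, hKm₁, hKmR₁⟩ := F₁.level_scales (K := L * (m + 17 + g)) ha hM hm1 hη₁ hR₁
  obtain ⟨-, haK₂, -, -⟩ := F₂.level_scales (K := L * (m + 17 + g)) ha hM hm1 hη₂ hR₂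
  have hTopR₁ : a * M ^ (L * (m + 17 + g)) * M ^ m ≤ F₁.Rmax := hKm₁ ▸ hKmR₁
  -- the anchors lie inside; the base walk of `G₁`
  obtain ⟨w₁, hw₁s⟩ := hw₁
  obtain ⟨w₂, hw₂s⟩ := hw₂
  have hin₁ : ∀ v ∈ w₁.support, v ∈ F₁.inSet (a * M ^ (L * (m + 17 + g))) := fun v hv =>
    ⟨(hw₁s v hv).1, by linarith [(hw₁s v hv).2, F₁.η_pos]⟩
  have hin₂ : ∀ v ∈ w₂.support, v ∈ F₂.inSet (a * M ^ (L * (m + 17 + g))) := fun v hv =>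
    ⟨(hw₂s v hv).1, by linarith [(hw₂s v hv).2, F₂.η_pos]⟩
  have hx₁ := hin₁ _ w₁.start_mem_support
  have hx'₁ := hin₁ _ w₁.end_mem_support
  have hx₂ := hin₂ _ w₂.start_mem_support
  have hx'₂ := hin₂ _ w₂.end_mem_support
  have hle₁ : fromEdgeSet (↑F₁.E : Set (Sym2 V₁)) ≤ G₁ := fun u v h => by
    rw [fromEdgeSet_adj, hE₁, Finset.mem_coe, mem_edgeFinset] at h
    exact h.1
  -- the four top-level decompositions over the window data
  obtain ⟨t₁, gx, e₁, ht₁, hgx, he₁0, he₁, hN₁⟩ := F₁.exists_windowSum_add_junk G₁ ι₁ W₀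
    (L * (m + 17 + g)) x y₁ hp hq hc1 ha hM hm1 hη₁ hE₁ hR₁ hL₁ hnb₁ hcore₁ hx₁ hy₁
  obtain ⟨t₁', gx', e₁', ht₁', hgx', he₁'0, he₁', hM₁⟩ := F₁.exists_windowSum_add_junk G₁ ι₁ W₀
    (L * (m + 17 + g)) x' y₁ hp hq hc1 ha hM hm1 hη₁ hE₁ hR₁ hL₁ hnb₁ hcore₁ hx'₁ hy₁
  obtain ⟨t₂, ux₂, e₂, ht₂, hux₂, he₂0, he₂, hN₂⟩ := F₂.exists_windowSum_add_junk G₂ ι₂ W₀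
    (L * (m + 17 + g)) x y₂ hp hq hc1 ha hM hm1 hη₂ hE₂ hR₂ hL₂ hnb₂ hcore₂ hx₂ hy₂
  obtain ⟨t₂', ux'₂, e₂', ht₂', hux'₂, he₂'0, he₂', hM₂⟩ := F₂.exists_windowSum_add_junk G₂ ι₂ W₀
    (L * (m + 17 + g)) x' y₂ hp hq hc1 ha hM hm1 hη₂ hE₂ hR₂ hL₂ hnb₂ hcore₂ hx'₂ hy₂
  rw [show t₁' = t₁ from funext fun d => by rw [ht₁ d, ht₁' d]] at hM₁
  rw [show t₂' = t₂ from funext fun d => by rw [ht₂ d, ht₂' d]] at hM₂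
  have ht₁0 : ∀ d, 0 ≤ t₁ d := fun d => by rw [ht₁ d]; exact measureReal_nonneg
  have ht₂0 : ∀ d, 0 ≤ t₂ d := fun d => by rw [ht₂ d]; exact measureReal_nonneg
  have hgx0 : ∀ d, 0 ≤ gx d := fun d => by
    rw [hgx d]; exact div_nonneg measureReal_nonneg measureReal_nonneg
  have hgx'0 : ∀ d, 0 ≤ gx' d := fun d => by
    rw [hgx' d]; exact div_nonneg measureReal_nonneg measureReal_nonneg
  -- transport of the inside probabilities of `G₂` to those of `G₁`
  have hT : a * M ^ (L * (m + 17 + g)) ≤ a * M ^ (L * (m + 17 + g)) * M ^ m := by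
    linarith [hTop₁, F₁.η_pos]
  have hTr : ∀ d, t₂ d * ux₂ d = t₂ d * gx d ∧ t₂ d * ux'₂ d = t₂ d * gx' d := by
    intro d
    by_cases h0 : t₂ d = 0
    · simp only [h0, zero_mul, and_self]
    have htpos : 0 < t₂ d := lt_of_le_of_ne (ht₂0 d) (Ne.symm h0)
    rw [ht₂ d] at htpos
    have hFpos := htpos.trans_le (measureReal_mono Set.inter_subset_left (measure_ne_top _ _))
    constructor
    · rw [hux₂ d, hgx d, F₁.insideCond_eq_of_frames F₂ G₁ G₂ ι₁ ι₂ W₀ x hp hq0 hT hadj hnb₁ hnb₂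
        hrad hgood hcore₁ hcore₂ hx₂ d hFpos]
    · rw [hux'₂ d, hgx' d, F₁.insideCond_eq_of_frames F₂ G₁ G₂ ι₁ ι₂ W₀ x' hp hq0 hT hadj hnb₁
        hnb₂ hrad hgood hcore₁ hcore₂ hx'₂ d hFpos]
  -- the positivity pattern `u_x(d) > 0 ↔ u_{x'}(d) > 0` in `G₁` (base-walk surgery)
  have hIB := F₁.inSet_disjoint_annSet (a * M ^ (L * (m + 17 + g))) (a * M ^ (L * (m + 17 + g)) * M ^ m)
  have hInadj := F₁.adj_inSet_subset G₁ hE₁ hTop₁ hTopR₁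
  have key : ∀ {n n' D : ℝ}, 0 ≤ n → n' ≤ D → (0 < n → 0 < n') → 0 < n / D → 0 < n' / D := by
    intro n n' D hn hle himp h
    have hn0 : 0 < n := by
      by_contra hn0
      rw [le_antisymm (not_lt.1 hn0) hn, zero_div] at h
      exact lt_irrefl _ h
    exact div_pos (himp hn0) ((himp hn0).trans_le hle)
  have hpat : ∀ d, (0 < gx d ↔ 0 < gx' d) := fun d => by
    rw [hgx d, hgx' d]
    exact ⟨key measureReal_nonneg (measureReal_mono Set.inter_subset_left (measure_ne_top _ _))
        (real_datumOff_insidePiece_pos_of_walk G₁ hp hq0 hIB hInadj ((w₁.mapLe hle₁).reverse)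
          (fun v hv => hin₁ v (by rwa [Walk.support_reverse, List.mem_reverse,
            Walk.support_mapLe_eq_support] at hv)) _ _),
      key measureReal_nonneg (measureReal_mono Set.inter_subset_left (measure_ne_top _ _))
        (real_datumOff_insidePiece_pos_of_walk G₁ hp hq0 hIB hInadj (w₁.mapLe hle₁)
          (fun v hv => hin₁ v (by rwa [Walk.support_mapLe_eq_support] at hv)) _ _)⟩
  -- the one-frame ratio bound, read for `G₁`
  have hG₁ : fromEdgeSet (↑F₁.E : Set (Sym2 V₁)) = G₁ := by
    rw [hE₁, coe_edgeFinset, fromEdgeSet_edgeSet]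
  have hmeas : rcMeasure (fromEdgeSet (↑F₁.E : Set (Sym2 V₁))) p q ∅ = rcMeasure G₁ p q ∅ :=
    rcMeasure_congr_graph hG₁ p q ∅
  have hcoe : (↑F₁.E : Set (Sym2 V₁)) = ↑G₁.edgeFinset := by rw [hE₁]
  rw [hmeas] at hRB
  rw [hcoe] at hRB
  have hRB' : ∀ d d₂ : Finset Wt × Finset Wt, 0 < gx d → 0 < gx d₂ →
      gx d * gx' d₂ ≤ Q L * (gx' d * gx d₂) := fun d d₂ => by
    rw [hgx d, hgx d₂, hgx' d, hgx' d₂]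
    exact hRB _ _ _ _
  -- the index set of the averaging: window data with positive inside probabilities
  obtain ⟨s, hsdef⟩ : ∃ s' : Finset (Finset Wt × Finset Wt),
      s' = Finset.univ.filter (fun d => 0 < gx' d) := ⟨_, rfl⟩
  have hs : ∀ d, d ∈ s ↔ 0 < gx' d := fun d => by
    rw [hsdef, Finset.mem_filter, and_iff_right (Finset.mem_univ d)]
  have hoff' : ∀ d, d ∉ s → gx' d = 0 := fun d hd =>
    le_antisymm (not_lt.1 fun h => hd ((hs d).2 h)) (hgx'0 d)
  have hoff : ∀ d, d ∉ s → gx d = 0 := fun d hd =>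
    le_antisymm (not_lt.1 fun h => hd ((hs d).2 ((hpat d).1 h))) (hgx0 d)
  have hsum : ∀ (t w : Finset Wt × Finset Wt → ℝ), (∀ d, d ∉ s → w d = 0) →
      ∑ d, t d * w d = ∑ d ∈ s, t d * w d := fun t w hw =>
    (Finset.sum_subset (Finset.subset_univ s) fun d _ hd => by rw [hw d hd, mul_zero]).symm
  rw [hsum t₁ gx hoff] at hN₁
  rw [hsum t₁ gx' hoff'] at hM₁
  rw [show ∑ d, t₂ d * ux₂ d = ∑ d ∈ s, t₂ d * gx d by
    rw [← hsum t₂ gx hoff]; exact Finset.sum_congr rfl fun d _ => (hTr d).1] at hN₂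
  rw [show ∑ d, t₂ d * ux'₂ d = ∑ d ∈ s, t₂ d * gx' d by
    rw [← hsum t₂ gx' hoff']; exact Finset.sum_congr rfl fun d _ => (hTr d).2] at hM₂
  -- the clean denominators are positive, so the index set is not empty
  have hS₁ : 0 < ∑ d ∈ s, t₁ d * gx' d := by
    have h := mul_lt_of_lt_one_left hM₁pos hε
    linarith
  have hS₂ : 0 < ∑ d ∈ s, t₂ d * gx' d := by
    have h := mul_lt_of_lt_one_left hM₂pos hε
    linarith
  have hsne : s.Nonempty := by
    by_contra h
    rw [Finset.not_nonempty_iff_eq_empty] at h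
    rw [h, Finset.sum_empty] at hS₁
    exact lt_irrefl _ hS₁
  -- the ratio bounds `A ≤ u_x/u_{x'} ≤ B`, `B ≤ Q_L A`
  obtain ⟨kA, hkA, hkAeq⟩ := Finset.exists_mem_eq_inf' hsne fun d => gx d / gx' d
  obtain ⟨kB, hkB, hkBeq⟩ := Finset.exists_mem_eq_sup' hsne fun d => gx d / gx' d
  have hx'A := (hs kA).1 hkA
  have hxA := (hpat kA).2 hx'A
  have hx'B := (hs kB).1 hkB
  have hxB := (hpat kB).2 hx'B
  have hA : 0 < s.inf' hsne fun d => gx d / gx' d := by rw [hkAeq]; exact div_pos hxA hx'A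
  have hBA : (s.sup' hsne fun d => gx d / gx' d) ≤ Q L * s.inf' hsne fun d => gx d / gx' d := by
    rw [hkAeq, hkBeq, div_le_iff₀ hx'B]
    have h := hRB' kB kA hxB hxA
    rw [show Q L * (gx kA / gx' kA) * gx' kB = Q L * (gx' kB * gx kA) / gx' kA by ring,
      le_div_iff₀ hx'A]
    linarith
  -- the averaging with overlap `β = 0`
  have hcard : (s.card : ℝ) ≠ 0 := Nat.cast_ne_zero.2 (Finset.card_ne_zero.2 hsne)
  have hD := Literature.Analysis.Convexity.Doeblin.ratio_div_ratio_le_of_overlap s gx gx' t₁ t₂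
    (fun _ => 1 / (s.card : ℝ)) (B := s.sup' hsne fun d => gx d / gx' d) (β := 0)
    (fun k hk => (hs k).1 hk) hA
    (fun k hk => ⟨Finset.inf'_le _ hk, Finset.le_sup' (fun d => gx d / gx' d) hk⟩)
    (fun k _ => ht₁0 k) (fun k _ => ht₂0 k) hS₁ hS₂ (fun _ _ => div_nonneg zero_le_one (Nat.cast_nonneg _))
    (by rw [Finset.sum_const, nsmul_eq_mul, mul_one_div, div_self hcard]) le_rfl zero_le_one
    (fun k _ => by rw [zero_mul, zero_mul]; exact mul_nonneg (ht₁0 k) (hgx'0 k))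
    (fun k _ => by rw [zero_mul, zero_mul]; exact mul_nonneg (ht₂0 k) (hgx'0 k))
    hε hN₁ hM₁ hN₂ hM₂ ⟨he₁0, he₁⟩ ⟨he₁'0, he₁'⟩ ⟨he₂0, he₂⟩ ⟨he₂'0, he₂'⟩
  -- conclusion
  have h1ε : 0 < (1 - (1 - c) ^ (m / 2)) ^ 2 := pow_pos (sub_pos.2 hε) 2
  have hC : (0 + (1 - 0) * (s.sup' hsne fun d => gx d / gx' d) / s.inf' hsne fun d => gx d / gx' d) /
      (1 - (1 - c) ^ (m / 2)) ^ 2 ≤ Q L / (1 - (1 - c) ^ (m / 2)) ^ 2 := by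
    refine div_le_div_of_nonneg_right ?_ h1ε.le
    rw [zero_add, sub_zero, one_mul, div_le_iff₀ hA]
    exact hBA
  have hratio := hD.trans (mul_le_mul_of_nonneg_right hC (div_nonneg measureReal_nonneg measureReal_nonneg))
  rw [div_le_iff₀ hM₁pos] at hratio
  calc (rcMeasure G₁ p q ∅).real (openConn (ι₁ x) y₁) * (rcMeasure G₂ p q ∅).real (openConn (ι₂ x') y₂)
      ≤ Q L / (1 - (1 - c) ^ (m / 2)) ^ 2 * ((rcMeasure G₂ p q ∅).real (openConn (ι₂ x) y₂) /
          (rcMeasure G₂ p q ∅).real (openConn (ι₂ x') y₂)) *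
          (rcMeasure G₁ p q ∅).real (openConn (ι₁ x') y₁) *
          (rcMeasure G₂ p q ∅).real (openConn (ι₂ x') y₂) :=
        mul_le_mul_of_nonneg_right hratio measureReal_nonneg
    _ = Q L / (1 - (1 - c) ^ (m / 2)) ^ 2 *
          ((rcMeasure G₁ p q ∅).real (openConn (ι₁ x') y₁) * (rcMeasure G₂ p q ∅).real (openConn (ι₂ x) y₂)) := by
        field_simp

end ScaleFrame

end Literature.Probability.LatticeModels
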